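import Literature.MathematicalPhysics.QuantumLattice.HubbardKuboKishiPairing
import Literature.MathematicalPhysics.QuantumLattice.HubbardKuboKishiGaussianDomination
import Literature.MathematicalPhysics.QuantumLattice.ShastryPairingInequalitiesProjectionProofs
import HarnessLib

/-!
# Hubbard ladder — Bounds: the on-site `s`-wave PAIRING SUSCEPTIBILITY of the half-filled repulsive
# torus is at most `1/(2U)` per site at EVERY temperature (Kubo–Kishi 1990, Thm 2 eq. (6)), UNCONDITIONAL

HONEST FRAMING (cell pub-hubbard): ladder R1–R4 with certified numbers; no claim on H/H₀. These
are bounds for a MODEL CLASS — the repulsive Hubbard torus `hamiltonianWith (fermionTorusGraph 2 L)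
1 U (U/2)` (`t = 1`, `U > 0`, `μ = U/2`, torus `(ℤ/Lℤ)²`, `L` even) in its grand-canonical Gibbs
state at `β > 0`; no materials claim. Companion text: `pub-hubbard/paper/bounds.tex` Remark 11 (7);
table `pub-hubbard/pub-hubbard-bounds/BOUNDS.md` row T9♭; `EXTREMISERS.md` §5q addendum.

The object is the Duhamel (Kubo–Mori) two-point function `(B†, B)_β = ∫₀¹ ⟨B† e^{-sβH} B e^{sβH}⟩_β ds`
(tree: `duhamel β H B† B`, normalised by `Z`), of Shastry's uniform on-site pair field
`B = Σ_x c_{x↓}c_{x↑} = uniformOnSitePair 2 L` (`= η_1`, `uniformOnSitePair_eq_conjTranspose_etaRaise`);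
`β (B†, B)_β` is the static uniform `s`-wave pairing susceptibility `χ_P · L²`. Kubo–Kishi's Theorem 2,
eq. (6) (`KuboKishi1990`; reprint `book:editornd-hubbard-model` p. 123, proof p. 125) bounds it by
`L²/(2U)` at every temperature: Gaussian domination for the attractive model (Dyson–Lieb–Simon trace
inequality) → Shiba's map → charge-field domination of the repulsive half-filled model (B0) → the
Duhamel bound `(F_a, F_a)_β ≤ Σa²/(βU)` (KK (10)) → the pseudospin Ward identity
`(F_ε, F_ε)_β = 2 (η†_1, η_1)_β` (`[η†_1, H - (U/2)N] = 0`, Zhang 1990). Every step is a theorem of the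
tree: `kuboKishi_charge_gaussianDomination_holds` (`HubbardKuboKishiGaussianDomination.lean`) and
`kuboKishi_uniformPairing_duhamel_le_torus` (`HubbardKuboKishiPairing.lean`). This file records the
cell's ladder node.

## What is proved (no `sorry`, no new axioms; UNCONDITIONAL)

* `ThermalOnSitePairSusceptibilityCeiling` (`_holds`): for even `L`, `U > 0`, `β > 0`,
  `Re (B†, B)_β ≤ L²/(2U)/β`, i.e. per site `χ_P^s := β (B†,B)_β / L² ≤ 1/(2U)` at every `T`;
* `ThermalOnSitePairSusceptibilityCeilingU20` (`_holds`): at `U = 20`, `Re (B†, B)_β ≤ L²/(40 β)`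
  (`χ_P^s ≤ 0.025/t`).
* `ThermalOnSitePairSusceptibilityCeilingProfile` (`_holds`): the same for EVERY real pair profile
  `c` (all momenta `q` at once): `Re (P_c†, P_c)_β ≤ Σ_x c_x²/(2U)/β`, `P_c = Σ_x c_x c_{x↓}c_{x↑}`
  (Kubo–Kishi's (6) "for all `q`").

Honest numbers: the bound is Kubo–Kishi's verbatim (grade: known, machine-checked); it is `T`-flat and
carries no kinetic input; the free-fermion susceptibility diverges logarithmically as `T → 0`, so the
ceiling is informative for `T ≲ t`; it concerns the ON-SITE channel only (nothing on extended-`s` /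
`d`-wave pair fields) and `μ = U/2` only (the Shiba step fails off half filling). The equal-time twin
(`⟨B†B⟩_β/L² ≤ T/(2U) + ½√(κ̃/U)`) is `Bounds/ThermalMottPairCeiling.lean`.
References (keys of `lean/references.bib`): KuboKishi1990 Thm 2 eq. (6); DysonLiebSimon1978 §3;
Shiba1972 §2; Zhang1990; YangZhang1990 Thm 1; Shastry1997 eq. (1).
-/

noncomputable section

namespace Summit.HubbardSuperconductivity.HubbardLadder.Bounds

open Matrix Finset Real
open Literature.MathematicalPhysics.QuantumLattice
open Literature.Probability.LatticeModels
open scoped ComplexOrder ComplexConjugate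

section Torus

/-- **Kubo–Kishi (6) on the half-filled repulsive torus, UNCONDITIONAL.** For even `L`, `U > 0`,
`β > 0` and `B = Σ_x c_{x↓}c_{x↑}`: `Re (B†, B)_β ≤ L²/(2U)/β` (per site `χ_P^s ≤ 1/(2U)` at every
temperature). -/
@[conjecture] def ThermalOnSitePairSusceptibilityCeiling : Prop :=
  ∀ (L : ℕ) [NeZero L], Even L → ∀ (U β : ℝ), 0 < U → 0 < β →
    (duhamel β (hamiltonianWith (fermionTorusGraph 2 L) 1 U (U / 2))
        (uniformOnSitePair 2 L)ᴴ (uniformOnSitePair 2 L)).re ≤ (L : ℝ) ^ 2 / (2 * U) / β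

/-- **`ThermalOnSitePairSusceptibilityCeiling` holds** (Kubo–Kishi's theorem, by name). -/
theorem thermalOnSitePairSusceptibilityCeiling_holds : ThermalOnSitePairSusceptibilityCeiling := by
  intro L _ hL U β hU hβ
  have h := kuboKishi_uniformPairing_duhamel_le_torus 2 L kuboKishi_charge_gaussianDomination_holds
    hL (t := 1) hU hβ
  have hcard : (Fintype.card (FermionTorus 2 L) : ℝ) = (L : ℝ) ^ 2 := by
    simp [FermionTorus, Fintype.card_lex]
  have hH : hubbardTorusWith 2 L 1 U (U / 2) = hamiltonianWith (fermionTorusGraph 2 L) 1 U (U / 2) :=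
    rfl
  rw [hcard, hH] at h
  rw [uniformOnSitePair_eq_conjTranspose_etaRaise, conjTranspose_conjTranspose]
  exact h

/-- **The instance at `U = 20`**: `Re (B†, B)_β ≤ L²/(40 β)`, i.e. `χ_P^s ≤ 0.025/t` at every `T`. -/
@[conjecture] def ThermalOnSitePairSusceptibilityCeilingU20 : Prop :=
  ∀ (L : ℕ) [NeZero L], Even L → ∀ β : ℝ, 0 < β →
    (duhamel β (hamiltonianWith (fermionTorusGraph 2 L) 1 20 (20 / 2))
        (uniformOnSitePair 2 L)ᴴ (uniformOnSitePair 2 L)).re ≤ (L : ℝ) ^ 2 / 40 / β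

/-- **`ThermalOnSitePairSusceptibilityCeilingU20` holds.** -/
theorem thermalOnSitePairSusceptibilityCeilingU20_holds :
    ThermalOnSitePairSusceptibilityCeilingU20 := by
  intro L _ hL β hβ
  have h := thermalOnSitePairSusceptibilityCeiling_holds L hL 20 β (by norm_num) hβ
  have e : (L : ℝ) ^ 2 / (2 * 20) / β = (L : ℝ) ^ 2 / 40 / β := by norm_num
  rw [e] at h
  exact h

/-- **Kubo–Kishi (6) for every pair profile (all `q`), UNCONDITIONAL.** For even `L`, `U > 0`, `β > 0`
and every real profile `c` on the torus, with `P_c† = Σ_x c_x c†_{x↑}c†_{x↓}` and `P_c = Σ_x c_x c_{x↓}c_{x↑}`: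
`Re (P_c†, P_c)_β ≤ Σ_x c_x²/(2U)/β` — the momentum-`q` pairing susceptibility is at most `1/(2U)` for
every `q` (take `c_x = cos(q·x)`, `sin(q·x)`). -/
@[conjecture] def ThermalOnSitePairSusceptibilityCeilingProfile : Prop :=
  ∀ (L : ℕ) [NeZero L], Even L → ∀ (U β : ℝ), 0 < U → 0 < β → ∀ c : FermionTorus 2 L → ℝ,
    (duhamel β (hamiltonianWith (fermionTorusGraph 2 L) 1 U (U / 2))
        (∑ x : FermionTorus 2 L, (c x : ℂ) • (creation (orb x 0) * creation (orb x 1)))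
        (∑ y : FermionTorus 2 L, (c y : ℂ) • (annihilation (orb y 1) * annihilation (orb y 0)))).re ≤
      (∑ x, c x ^ 2) / (2 * U) / β

/-- **`ThermalOnSitePairSusceptibilityCeilingProfile` holds** (Kubo–Kishi's theorem on the bipartite
torus graph, sign `torusStagger`; the `convert` only aligns the torus's structural `DecidableEq`
instance with the order-derived one of the generic lemma). -/
theorem thermalOnSitePairSusceptibilityCeilingProfile_holds :
    ThermalOnSitePairSusceptibilityCeilingProfile := by
  intro L _ hL U β hU hβ c
  convert kuboKishi_pairing_duhamel_le (fermionTorusGraph 2 L) kuboKishi_charge_gaussianDomination_holds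
    torusStagger (fun _ _ h => torusStagger_eq_neg_of_adj_holds hL h) (t := 1) hU hβ c using 3

end Torus

end Summit.HubbardSuperconductivity.HubbardLadder.Bounds
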